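import Summits.QuantumFields.GaugeBoot.TiltedBoxRedSiteCupIntegral
import HarnessLib

/-!
# The reduced half of the site mirror of the even square tilted box: the tube as two cups (gauge-boot, L3 supplement: reduced-half in-plane mirrors, 6c/7)

HONEST FRAMING (cell `pub-gaugeboot`, page 1 of every file): the venture produces certified bounds
on lattice expectations at stated coupling, gauge group, dimension and torus size; NOT a mass gap,
NOT a continuum limit, NOT a string tension; NOT Yang–Mills-summit-bearing (barriers
`FixedCouplingUltralocality`, `PerturbativeInvisibility`). This module is bookkeeping for a small
structural NEGATIVE result (the REDUCED-half in-plane mirrors of the square tilted boxes are not of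
positive type in `d ≥ 3` at small coupling); it discharges nothing by itself.

## Content (even box, `P ≥ 2`, `L ≥ 2`)

For the near pair `v = (z; q)` (layer `P - 1`), `u = v + 2e_i` (layer `P + 1`):

* `prod_tube_eq` — a product over the tube is the product over the four standing plaquettes of `v`
  times the product over the four hanging plaquettes of `u`;
* `not_hasLink_hang_lower` — the hanging plaquettes (and `u`) do not read the links of `v`;
* ★ **the mirror turns the upper cup into a lower cup**: under the site mirror `Θ_i`
  (`σ z = z + 2e_i + T`), `u ↦ v + T`, the hanging plaquette under the `a`-th link of `u` ↦ the
  standing plaquette on the `a`-th link of `v + T`, and the ring `v + e_i ↦ (v + T) + e_i`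
  (`plaqObs_upper_configReflect`, `plaqObs_hang_configReflect`, `plaqObs_ring_configReflect`); with
  the `Θ_i`-invariance of the product Haar measure,
  ★ **`integral_ring_upper_eq`**:
  `∫ W_{v+e_i} · W_u ∏_a W_{H_a} ∏ dU = ∫ W_{v+T} ∏_a W_{S_a(v+T)} · W_{v+T+e_i} ∏ dU`.

So the upper half of the tube needs no second gluing computation. Elementary.
-/

noncomputable section

open QuotientAddGroup Finset Function MeasureTheory
open Literature.MathematicalPhysics.QuantumFieldTheory (haarProbability)
open Literature.MathematicalPhysics.QuantumFieldTheory.PlaquetteLowerBound (reTr)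
open Literature.RepresentationTheory.CompactGroups

namespace Summit.QuantumFields.GaugeBoot

namespace TiltedRP

namespace RedSite

variable {d : ℕ} {i j : Fin d} {L P N : ℕ} [NeZero L] [NeZero P]
  [DecidableEq (TiltedSite d i j (2 * P) (2 * P) L)]
variable {G : Type*} [Group G] [TopologicalSpace G] [IsTopologicalGroup G] [CompactSpace G]
  [MeasurableSpace G] [BorelSpace G] [SecondCountableTopology G]
variable (ρ : G →* Matrix (Fin N) (Fin N) ℂ) (q : DirPair d)

/-! ## Products over the tube -/

omit [NeZero L] [NeZero P] in
/-- **A product over the tube splits into the standing and the hanging plaquettes.** [folklore] -/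
theorem prod_tube_eq (hP : 2 ≤ P) (hij : i ≠ j) (hL : 2 ≤ L) (hq1 : q.1.1 ≠ i) (hq2 : q.1.2 ≠ i)
    {z w : TiltedSite d i j (2 * P) (2 * P) L} (hz : (axisCoord d L (2 * P) z).val = P - 1)
    (hw : (axisCoord d L (2 * P) w).val = P + 1) (f : Plaq (TiltedSite d i j (2 * P) (2 * P) L) d → ℝ) :
    ∏ p ∈ tube q (w, q) (z, q), f p =
      (∏ a : Fin 4, f (stand q (PairExp.plink (tiltedUnit d i j (2 * P) (2 * P) L) (z, q) a))) *
        ∏ a : Fin 4, f (hang q (PairExp.plink (tiltedUnit d i j (2 * P) (2 * P) L) (w, q) a)) := by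
  have he := tiltedUnit_ne_zero_all (d := d) hP hij hL
  have hinjS : Function.Injective fun a : Fin 4 =>
      stand q (PairExp.plink (tiltedUnit d i j (2 * P) (2 * P) L) ((z, q) : Plaq _ d) a) := by
    intro a b hab
    exact PairExp.plink_injective _ he _ (stand_injective q (hasLink_transverse q hq1 hq2 z ⟨a, rfl⟩).2
      (hasLink_transverse q hq1 hq2 z ⟨b, rfl⟩).2 hab)
  have hinjH : Function.Injective fun a : Fin 4 =>
      hang q (PairExp.plink (tiltedUnit d i j (2 * P) (2 * P) L) ((w, q) : Plaq _ d) a) := by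
    intro a b hab
    exact PairExp.plink_injective _ he _ (hang_injective q (hasLink_transverse q hq1 hq2 w ⟨a, rfl⟩).2
      (hasLink_transverse q hq1 hq2 w ⟨b, rfl⟩).2 hab)
  have hdisj : Disjoint (univ.image fun a : Fin 4 => stand q (PairExp.plink (tiltedUnit d i j (2 * P) (2 * P) L) ((z, q) : Plaq _ d) a))
      (univ.image fun a : Fin 4 => hang q (PairExp.plink (tiltedUnit d i j (2 * P) (2 * P) L) ((w, q) : Plaq _ d) a)) := by
    rw [disjoint_left]
    intro p hp hp'
    rw [mem_image] at hp hp'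
    obtain ⟨a, -, rfl⟩ := hp
    obtain ⟨b, -, hb⟩ := hp'
    refine stand_ne_hang q hP (ℓ' := PairExp.plink (tiltedUnit d i j (2 * P) (2 * P) L) ((w, q) : Plaq _ d) b) ?_ ?_ hb.symm
    · rw [(hasLink_transverse q hq1 hq2 z ⟨a, rfl⟩).1, hz]
    · rw [(hasLink_transverse q hq1 hq2 w ⟨b, rfl⟩).1, hw]
  unfold tube
  rw [prod_union hdisj, prod_image fun a _ b _ h => hinjS h, prod_image fun a _ b _ h => hinjH h]

omit [NeZero L] [NeZero P] [DecidableEq (TiltedSite d i j (2 * P) (2 * P) L)] in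
/-- **The hanging plaquettes of the upper observable do not read the links of the lower one** (their
transverse links lie in the layers `P` and `P + 1`, their rungs have direction `i`). [folklore] -/
theorem not_hasLink_hang_lower (hP : 2 ≤ P) (hq1 : q.1.1 ≠ i) (hq2 : q.1.2 ≠ i)
    {z w : TiltedSite d i j (2 * P) (2 * P) L} (hz : (axisCoord d L (2 * P) z).val = P - 1)
    (hw : (axisCoord d L (2 * P) w).val = P + 1) (a b : Fin 4) :
    ¬ PairExp.HasLink (tiltedUnit d i j (2 * P) (2 * P) L)
      (hang q (PairExp.plink (tiltedUnit d i j (2 * P) (2 * P) L) (w, q) a))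
      (PairExp.plink (tiltedUnit d i j (2 * P) (2 * P) L) (z, q) b) := by
  obtain ⟨hlw, hdw⟩ := hasLink_transverse q hq1 hq2 w (ℓ := PairExp.plink (tiltedUnit d i j (2 * P) (2 * P) L) ((w, q) : Plaq _ d) a) ⟨a, rfl⟩
  obtain ⟨hlz, hdz⟩ := hasLink_transverse q hq1 hq2 z (ℓ := PairExp.plink (tiltedUnit d i j (2 * P) (2 * P) L) ((z, q) : Plaq _ d) b) ⟨b, rfl⟩
  rw [← Prod.mk.eta (p := PairExp.plink (tiltedUnit d i j (2 * P) (2 * P) L) ((w, q) : Plaq _ d) a), hasLink_hang_iff q hdw,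
    ← Prod.mk.eta (p := PairExp.plink (tiltedUnit d i j (2 * P) (2 * P) L) ((z, q) : Plaq _ d) b)]
  rintro (h | h | h | h)
  · exact hdz (Prod.mk.inj h).2
  · have h1 := congrArg (fun x => (axisCoord d L (2 * P) x).val) (Prod.mk.inj h).1
    rw [hlz, hz, hlw, hw] at h1; omega
  · exact hdz (Prod.mk.inj h).2
  · have h1 := congrArg (fun x => (axisCoord d L (2 * P) x).val) (Prod.mk.inj h).1
    have h2 := val_axisCoord_sub_self hP (PairExp.plink (tiltedUnit d i j (2 * P) (2 * P) L) ((w, q) : Plaq _ d) a).1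
      (by rw [hlw, hw]; omega)
    rw [hlw, hw] at h2; rw [hlz, hz] at h1; omega

/-! ## The mirror turns the upper cup into a lower cup -/

section Reflect

variable {z : TiltedSite d i j (2 * P) (2 * P) L}

omit [NeZero L] [NeZero P] [DecidableEq (TiltedSite d i j (2 * P) (2 * P) L)] in
/-- `x_i(z) = P - 1` as an identity in `ZMod (2P)`. [folklore] -/
theorem axisCoord_eq_pred_of_val (hP : 2 ≤ P) (hz : (axisCoord d L (2 * P) z).val = P - 1) :
    axisCoord d L (2 * P) z = ((P : ℕ) : ZMod (2 * P)) - 1 := by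
  haveI : NeZero (2 * P) := ⟨by omega⟩
  apply ZMod.val_injective
  rw [hz, TwoDim.val_natCast_sub_one hP]

omit [NeZero L] [NeZero P] [DecidableEq (TiltedSite d i j (2 * P) (2 * P) L)] in
/-- `σ z = z + 2e_i + T` on the layer `P - 1`. [folklore] -/
theorem flip_base (hP : 2 ≤ P) (hij : i ≠ j) (hz : (axisCoord d L (2 * P) z).val = P - 1) :
    tiltedAxisFlip d L (2 * P) hij z =
      z + tiltedUnit d i j (2 * P) (2 * P) L i + tiltedUnit d i j (2 * P) (2 * P) L i + tiltedTwist d L (2 * P) :=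
  TwoDim.tiltedAxisFlip_of_axisCoord_eq_pred hij z (axisCoord_eq_pred_of_val hP hz)

omit [NeZero L] [NeZero P] [DecidableEq (TiltedSite d i j (2 * P) (2 * P) L)] in
/-- `σ (z + 2e_i + e_m) = z + T + e_m` for `m ≠ i` (and `σ (z + 2e_i) = z + T`). [folklore] -/
theorem flip_upper_add (hP : 2 ≤ P) (hij : i ≠ j) (hz : (axisCoord d L (2 * P) z).val = P - 1) {m : Fin d} (hm : m ≠ i) :
    tiltedAxisFlip d L (2 * P) hij (z + tiltedUnit d i j (2 * P) (2 * P) L i + tiltedUnit d i j (2 * P) (2 * P) L i +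
        tiltedUnit d i j (2 * P) (2 * P) L m) =
      z + tiltedTwist d L (2 * P) + tiltedUnit d i j (2 * P) (2 * P) L m := by
  have hF := isAxisFlip_tiltedAxisFlip d L (2 * P) hij
  rw [hF.map_add_other _ hm, hF.map_add_self, hF.map_add_self, flip_base hP hij hz]
  abel

omit [NeZero L] [NeZero P] [DecidableEq (TiltedSite d i j (2 * P) (2 * P) L)] in
/-- `σ (z + 2e_i) = z + T`. [folklore] -/
theorem flip_upper (hP : 2 ≤ P) (hij : i ≠ j) (hz : (axisCoord d L (2 * P) z).val = P - 1) :
    tiltedAxisFlip d L (2 * P) hij (z + tiltedUnit d i j (2 * P) (2 * P) L i + tiltedUnit d i j (2 * P) (2 * P) L i) =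
      z + tiltedTwist d L (2 * P) := by
  have hF := isAxisFlip_tiltedAxisFlip d L (2 * P) hij
  rw [hF.map_add_self, hF.map_add_self, flip_base hP hij hz]
  abel

omit [NeZero L] [NeZero P] [DecidableEq (TiltedSite d i j (2 * P) (2 * P) L)] in
/-- The mirror maps the base of the `a`-th link of `u = (z + 2e_i; q)` to the base of the `a`-th link of
`v + T = (z + T; q)`. [folklore] -/
theorem flip_plink_upper (hP : 2 ≤ P) (hij : i ≠ j) (hq1 : q.1.1 ≠ i) (hq2 : q.1.2 ≠ i)
    (hz : (axisCoord d L (2 * P) z).val = P - 1) (a : Fin 4) :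
    (tiltedAxisFlip d L (2 * P) hij
        (PairExp.plink (tiltedUnit d i j (2 * P) (2 * P) L)
          ((z + tiltedUnit d i j (2 * P) (2 * P) L i + tiltedUnit d i j (2 * P) (2 * P) L i, q) : Plaq _ d) a).1,
      (PairExp.plink (tiltedUnit d i j (2 * P) (2 * P) L)
          ((z + tiltedUnit d i j (2 * P) (2 * P) L i + tiltedUnit d i j (2 * P) (2 * P) L i, q) : Plaq _ d) a).2) =
      PairExp.plink (tiltedUnit d i j (2 * P) (2 * P) L) ((z + tiltedTwist d L (2 * P), q) : Plaq _ d) a := by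
  fin_cases a
  · simp only [PairExp.plink]; rw [flip_upper hP hij hz]
  · simp only [PairExp.plink]; rw [flip_upper_add hP hij hz hq1]
  · simp only [PairExp.plink]; rw [flip_upper_add hP hij hz hq2]
  · simp only [PairExp.plink]; rw [flip_upper hP hij hz]


omit [NeZero L] [NeZero P] [DecidableEq (TiltedSite d i j (2 * P) (2 * P) L)] [MeasurableSpace G] [BorelSpace G]
  [SecondCountableTopology G] in
/-- **The mirror image of the upper observable is the lower observable translated by `T`**:
`W_u(Θ_i U) = W_{v+T}(U)`. [folklore] -/
theorem plaqObs_upper_configReflect (hP : 2 ≤ P) (hij : i ≠ j) (hq1 : q.1.1 ≠ i) (hq2 : q.1.2 ≠ i) (hρ : Continuous ρ)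
    (hz : (axisCoord d L (2 * P) z).val = P - 1) (U : Config (TiltedSite d i j (2 * P) (2 * P) L) d G) :
    plaqObs ρ (tiltedUnit d i j (2 * P) (2 * P) L)
        (z + tiltedUnit d i j (2 * P) (2 * P) L i + tiltedUnit d i j (2 * P) (2 * P) L i, q)
        (configReflect (tiltedUnit d i j (2 * P) (2 * P) L) i (tiltedAxisFlip d L (2 * P) hij) U) =
      plaqObs ρ (tiltedUnit d i j (2 * P) (2 * P) L) (z + tiltedTwist d L (2 * P), q) U := by
  have hF := isAxisFlip_tiltedAxisFlip d L (2 * P) hij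
  have hnot : ¬ HasDir ((z + tiltedUnit d i j (2 * P) (2 * P) L i + tiltedUnit d i j (2 * P) (2 * P) L i, q) : Plaq _ d) i :=
    fun h => h.elim hq1 hq2
  rw [hF.plaqObs_configReflect ρ hρ, show IsSiteFrame.plaqReflect (tiltedUnit d i j (2 * P) (2 * P) L) i
    (tiltedAxisFlip d L (2 * P) hij) (z + tiltedUnit d i j (2 * P) (2 * P) L i + tiltedUnit d i j (2 * P) (2 * P) L i, q) =
    (z + tiltedTwist d L (2 * P), q) from Prod.ext ((IsSiteFrame.plaqReflect_fst_of_not_hasDir hnot).trans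
      (flip_upper hP hij hz)) (IsSiteFrame.plaqReflect_snd _)]

omit [NeZero L] [NeZero P] [DecidableEq (TiltedSite d i j (2 * P) (2 * P) L)] [MeasurableSpace G] [BorelSpace G]
  [SecondCountableTopology G] in
/-- **The mirror image of the ring above `v` is the ring above `v + T`.** [folklore] -/
theorem plaqObs_ring_configReflect (hP : 2 ≤ P) (hij : i ≠ j) (hq1 : q.1.1 ≠ i) (hq2 : q.1.2 ≠ i) (hρ : Continuous ρ)
    (hz : (axisCoord d L (2 * P) z).val = P - 1) (U : Config (TiltedSite d i j (2 * P) (2 * P) L) d G) :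
    plaqObs ρ (tiltedUnit d i j (2 * P) (2 * P) L) (z + tiltedUnit d i j (2 * P) (2 * P) L i, q)
        (configReflect (tiltedUnit d i j (2 * P) (2 * P) L) i (tiltedAxisFlip d L (2 * P) hij) U) =
      plaqObs ρ (tiltedUnit d i j (2 * P) (2 * P) L) (z + tiltedTwist d L (2 * P) + tiltedUnit d i j (2 * P) (2 * P) L i, q) U := by
  have hF := isAxisFlip_tiltedAxisFlip d L (2 * P) hij
  have hnot : ¬ HasDir ((z + tiltedUnit d i j (2 * P) (2 * P) L i, q) : Plaq _ d) i := fun h => h.elim hq1 hq2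
  have hσ : tiltedAxisFlip d L (2 * P) hij (z + tiltedUnit d i j (2 * P) (2 * P) L i) =
      z + tiltedTwist d L (2 * P) + tiltedUnit d i j (2 * P) (2 * P) L i := by
    rw [hF.map_add_self, flip_base hP hij hz]; abel
  rw [hF.plaqObs_configReflect ρ hρ, show IsSiteFrame.plaqReflect (tiltedUnit d i j (2 * P) (2 * P) L) i
    (tiltedAxisFlip d L (2 * P) hij) (z + tiltedUnit d i j (2 * P) (2 * P) L i, q) =
    (z + tiltedTwist d L (2 * P) + tiltedUnit d i j (2 * P) (2 * P) L i, q) from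
      Prod.ext ((IsSiteFrame.plaqReflect_fst_of_not_hasDir hnot).trans hσ) (IsSiteFrame.plaqReflect_snd _)]

omit [NeZero L] [NeZero P] [DecidableEq (TiltedSite d i j (2 * P) (2 * P) L)] [MeasurableSpace G] [BorelSpace G]
  [SecondCountableTopology G] in
/-- **The mirror image of the hanging plaquette under the `a`-th link of `u` is the standing plaquette
on the `a`-th link of `v + T`.** [folklore] -/
theorem plaqObs_hang_configReflect (hP : 2 ≤ P) (hij : i ≠ j) (hq1 : q.1.1 ≠ i) (hq2 : q.1.2 ≠ i) (hρ : Continuous ρ)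
    (hz : (axisCoord d L (2 * P) z).val = P - 1) (a : Fin 4) (U : Config (TiltedSite d i j (2 * P) (2 * P) L) d G) :
    plaqObs ρ (tiltedUnit d i j (2 * P) (2 * P) L)
        (hang q (PairExp.plink (tiltedUnit d i j (2 * P) (2 * P) L)
          ((z + tiltedUnit d i j (2 * P) (2 * P) L i + tiltedUnit d i j (2 * P) (2 * P) L i, q) : Plaq _ d) a))
        (configReflect (tiltedUnit d i j (2 * P) (2 * P) L) i (tiltedAxisFlip d L (2 * P) hij) U) =
      plaqObs ρ (tiltedUnit d i j (2 * P) (2 * P) L)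
        (stand q (PairExp.plink (tiltedUnit d i j (2 * P) (2 * P) L) ((z + tiltedTwist d L (2 * P), q) : Plaq _ d) a)) U := by
  have hF := isAxisFlip_tiltedAxisFlip d L (2 * P) hij
  set ℓ := PairExp.plink (tiltedUnit d i j (2 * P) (2 * P) L)
    ((z + tiltedUnit d i j (2 * P) (2 * P) L i + tiltedUnit d i j (2 * P) (2 * P) L i, q) : Plaq _ d) a with hℓ
  have hdir : ℓ.2 ≠ i := (hasLink_transverse q hq1 hq2 _ ⟨a, rfl⟩).2
  have hhas : HasDir (hang q ℓ) i := stdDir_hasDir q hdir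
  rw [hF.plaqObs_configReflect ρ hρ, ← flip_plink_upper q hP hij hq1 hq2 hz a]
  congr 1
  refine Prod.ext ?_ ?_
  · rw [IsSiteFrame.plaqReflect_fst_of_hasDir hhas]
    show tiltedAxisFlip d L (2 * P) hij (ℓ.1 - tiltedUnit d i j (2 * P) (2 * P) L i) - tiltedUnit d i j (2 * P) (2 * P) L i = _
    rw [hF.map_sub_self, add_sub_cancel_right]; rfl
  · rw [IsSiteFrame.plaqReflect_snd]; rfl


omit [DecidableEq (TiltedSite d i j (2 * P) (2 * P) L)] in
/-- ★ **The mirror turns the upper cup into a lower cup**: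
`∫ W_{v+e_i} · (W_u ∏_a W_{H_a}) ∏ dU = ∫ W_{v+T} ∏_a W_{S_a(v+T)} · W_{v+T+e_i} ∏ dU`
(`Θ_i`-invariance of the product Haar measure). [folklore] -/
theorem integral_ring_upper_eq (hP : 2 ≤ P) (hij : i ≠ j) (hq1 : q.1.1 ≠ i) (hq2 : q.1.2 ≠ i) (hρ : Continuous ρ)
    (hz : (axisCoord d L (2 * P) z).val = P - 1) :
    ∫ U, plaqObs ρ (tiltedUnit d i j (2 * P) (2 * P) L) (z + tiltedUnit d i j (2 * P) (2 * P) L i, q) U *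
        (plaqObs ρ (tiltedUnit d i j (2 * P) (2 * P) L)
            (z + tiltedUnit d i j (2 * P) (2 * P) L i + tiltedUnit d i j (2 * P) (2 * P) L i, q) U *
          ∏ a : Fin 4, plaqObs ρ (tiltedUnit d i j (2 * P) (2 * P) L)
            (hang q (PairExp.plink (tiltedUnit d i j (2 * P) (2 * P) L)
              ((z + tiltedUnit d i j (2 * P) (2 * P) L i + tiltedUnit d i j (2 * P) (2 * P) L i, q) : Plaq _ d) a)) U)
        ∂(productHaar (TiltedSite d i j (2 * P) (2 * P) L) d G) =
      ∫ U, plaqObs ρ (tiltedUnit d i j (2 * P) (2 * P) L) (z + tiltedTwist d L (2 * P), q) U *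
        (∏ a : Fin 4, plaqObs ρ (tiltedUnit d i j (2 * P) (2 * P) L)
            (stand q (PairExp.plink (tiltedUnit d i j (2 * P) (2 * P) L) ((z + tiltedTwist d L (2 * P), q) : Plaq _ d) a)) U) *
        plaqObs ρ (tiltedUnit d i j (2 * P) (2 * P) L) (z + tiltedTwist d L (2 * P) + tiltedUnit d i j (2 * P) (2 * P) L i, q) U
        ∂(productHaar (TiltedSite d i j (2 * P) (2 * P) L) d G) := by
  have hF := isAxisFlip_tiltedAxisFlip d L (2 * P) hij
  have hmp := hF.measurePreserving_configReflect (G := G)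
  -- the reflected integrand
  have hcomp : ∀ U : Config (TiltedSite d i j (2 * P) (2 * P) L) d G,
      plaqObs ρ (tiltedUnit d i j (2 * P) (2 * P) L) (z + tiltedUnit d i j (2 * P) (2 * P) L i, q) (configReflect (tiltedUnit d i j (2 * P) (2 * P) L) i (tiltedAxisFlip d L (2 * P) hij) U) *
        (plaqObs ρ (tiltedUnit d i j (2 * P) (2 * P) L) (z + tiltedUnit d i j (2 * P) (2 * P) L i + tiltedUnit d i j (2 * P) (2 * P) L i, q) (configReflect (tiltedUnit d i j (2 * P) (2 * P) L) i (tiltedAxisFlip d L (2 * P) hij) U) *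
          ∏ a : Fin 4, plaqObs ρ (tiltedUnit d i j (2 * P) (2 * P) L) (hang q (PairExp.plink (tiltedUnit d i j (2 * P) (2 * P) L) ((z + tiltedUnit d i j (2 * P) (2 * P) L i + tiltedUnit d i j (2 * P) (2 * P) L i, q) : Plaq _ d) a))
            (configReflect (tiltedUnit d i j (2 * P) (2 * P) L) i (tiltedAxisFlip d L (2 * P) hij) U)) =
      plaqObs ρ (tiltedUnit d i j (2 * P) (2 * P) L) (z + tiltedTwist d L (2 * P), q) U *
        (∏ a : Fin 4, plaqObs ρ (tiltedUnit d i j (2 * P) (2 * P) L) (stand q (PairExp.plink (tiltedUnit d i j (2 * P) (2 * P) L) ((z + tiltedTwist d L (2 * P), q) : Plaq _ d) a)) U) *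
        plaqObs ρ (tiltedUnit d i j (2 * P) (2 * P) L) (z + tiltedTwist d L (2 * P) + tiltedUnit d i j (2 * P) (2 * P) L i, q) U := by
    intro U
    rw [plaqObs_ring_configReflect ρ q hP hij hq1 hq2 hρ hz, plaqObs_upper_configReflect ρ q hP hij hq1 hq2 hρ hz]
    simp_rw [plaqObs_hang_configReflect ρ q hP hij hq1 hq2 hρ hz]
    ring
  have hm : Measurable fun U : Config (TiltedSite d i j (2 * P) (2 * P) L) d G =>
      plaqObs ρ (tiltedUnit d i j (2 * P) (2 * P) L) (z + tiltedUnit d i j (2 * P) (2 * P) L i, q) U * (plaqObs ρ (tiltedUnit d i j (2 * P) (2 * P) L) (z + tiltedUnit d i j (2 * P) (2 * P) L i + tiltedUnit d i j (2 * P) (2 * P) L i, q) U *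
        ∏ a : Fin 4, plaqObs ρ (tiltedUnit d i j (2 * P) (2 * P) L) (hang q (PairExp.plink (tiltedUnit d i j (2 * P) (2 * P) L) ((z + tiltedUnit d i j (2 * P) (2 * P) L i + tiltedUnit d i j (2 * P) (2 * P) L i, q) : Plaq _ d) a)) U) :=
    ((continuous_plaqObs ρ hρ _ _).mul ((continuous_plaqObs ρ hρ _ _).mul
      (continuous_finsetProd _ fun a _ => continuous_plaqObs ρ hρ _ _))).measurable
  calc _ = ∫ U, (fun V => plaqObs ρ (tiltedUnit d i j (2 * P) (2 * P) L) (z + tiltedUnit d i j (2 * P) (2 * P) L i, q) V * (plaqObs ρ (tiltedUnit d i j (2 * P) (2 * P) L) (z + tiltedUnit d i j (2 * P) (2 * P) L i + tiltedUnit d i j (2 * P) (2 * P) L i, q) V *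
          ∏ a : Fin 4, plaqObs ρ (tiltedUnit d i j (2 * P) (2 * P) L) (hang q (PairExp.plink (tiltedUnit d i j (2 * P) (2 * P) L) ((z + tiltedUnit d i j (2 * P) (2 * P) L i + tiltedUnit d i j (2 * P) (2 * P) L i, q) : Plaq _ d) a)) V))
          (configReflect (tiltedUnit d i j (2 * P) (2 * P) L) i (tiltedAxisFlip d L (2 * P) hij) U) ∂(productHaar (TiltedSite d i j (2 * P) (2 * P) L) d G) := by
        rw [← integral_map hmp.measurable.aemeasurable hm.aestronglyMeasurable, hmp.map_eq]
    _ = _ := integral_congr_ae (ae_of_all _ fun U => hcomp U)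

end Reflect

end RedSite

end TiltedRP

end Summit.QuantumFields.GaugeBoot

end
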